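import Mathlib
import Summits.Ventures.PercRepro2.OneTypedEdge

/-!
# The marks `b` and `a₃` behind an unmarked cut vertex, I: the kernel on the states (blind cell
PercRepro2, p3 g3, 2026-08-25; `proofs/P3-BRIDGE.md` §11.9 (b))

When an unmarked cut vertex `c` separates `VH ∋ a₁, a₂, o` from `VL ∋ b, a₃`, a copy of the support
has the state `gluedBA r go g3` with `r : R5b` the five root-side bits `(a₂ ↔ a₁, a₁ ↔ c, a₂ ↔ c,
a₁ ↔ o, a₂ ↔ o)` and `gb, g3` the far bits `c ↔ b`, `c ↔ a₃`.  The kernel is LINEAR in the `b`-bits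
(`KB_gluedBA_lin`: one `b`-factor per term, a ring identity) and, for a fixed `b`-copy, sorted by the
exact `a₃`-pattern (`KB_gluedBA_pat`).  On VALID root bits (`Valid5b`) the six-fold symmetrised
pattern kernels `symBA` satisfy the three ORBIT identities `orbitBA_a` … `orbitBA_c` (`decide` over
the `13³` valid triples): an `a₃` in the `b`-copy is invisible after symmetrisation — the root-side
content of the three-gadget decomposition.  Own work; standard axioms.
-/

namespace Summit.Ventures.PercRepro2

namespace CovForm

namespace RootBridge

open OneTyped

/-- The five root-side bits `(a₂ ↔ a₁, a₁ ↔ c, a₂ ↔ c, a₁ ↔ o, a₂ ↔ o)`. -/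
abbrev R5b := Bool × Bool × Bool × Bool × Bool

namespace R5b
/-- `a₂ ↔ a₁`. -/
def q (r : R5b) : Bool := r.1
/-- `a₁ ↔ c`. -/
def a1 (r : R5b) : Bool := r.2.1
/-- `a₂ ↔ c`. -/
def a2 (r : R5b) : Bool := r.2.2.1
/-- `a₁ ↔ o`. -/
def lo (r : R5b) : Bool := r.2.2.2.1
/-- `a₂ ↔ o`. -/
def ho (r : R5b) : Bool := r.2.2.2.2
end R5b

/-- The state of a copy when `b, a₃` sit beyond `c` and `a₁, a₂, o` on the other side. -/
def gluedBA (r : R5b) (gb g3 : Bool) : St :=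
  (r.q, r.lo, r.ho, r.a1 && gb, r.a2 && gb, r.a1 && g3, r.a2 && g3)

/-- A far bit as an integer. -/
def indBA (g : Bool) : ℤ := if g then 1 else 0

/-- `indBA true = 1`. -/
@[simp] lemma indBA_true : indBA true = 1 := rfl
/-- `indBA false = 0`. -/
@[simp] lemma indBA_false : indBA false = 0 := rfl

/-- The kernel on glued states with prescribed `b`-bits and `a₃`-bits. -/
def patBA (bx by_ bw sx sy sw : Bool) (rx ry rw : R5b) : ℤ :=
  KB (gluedBA rx bx sx) (gluedBA ry by_ sy) (gluedBA rw bw sw)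

/-- `σ` of a gated pair of bits. -/
lemma sigB_and' (a b g : Bool) : sigB (a && g) (b && g) = sigB a b * indBA g := by
  cases a <;> cases b <;> cases g <;> simp [sigB, indBA]

/-- `u` of a gated pair of bits. -/
lemma uB_and' (a b g : Bool) : uB (a && g) (b && g) = uB a b * indBA g := by
  cases a <;> cases b <;> cases g <;> simp [uB, indBA]

/-- **The kernel is linear in the three `b`-bits** (one `o`-factor per term). -/
theorem KB_gluedBA_lin (bx by_ bw sx sy sw : Bool) (rx ry rw : R5b) :
    patBA bx by_ bw sx sy sw rx ry rw =
      patBA true false false sx sy sw rx ry rw * indBA bx +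
        patBA false true false sx sy sw rx ry rw * indBA by_ +
        patBA false false true sx sy sw rx ry rw * indBA bw := by
  unfold patBA KB
  simp only [gluedBA, qB, pdB, St.q', St.Lo, St.Ho, St.Lb, St.Hb, St.L3, St.H3, sigB_and', uB_and',
    indBA_true, indBA_false, mul_one, mul_zero]
  ring

/-- The exact `a₃`-pattern indicator. -/
def exactBA (sx sy sw gx gy gw : Bool) : ℤ :=
  (if gx = sx then 1 else 0) * (if gy = sy then 1 else 0) * (if gw = sw then 1 else 0)

/-- **For fixed `b`-bits the kernel is sorted by the exact `a₃`-pattern**. -/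
theorem KB_gluedBA_pat (bx by_ bw gx gy gw : Bool) (rx ry rw : R5b) :
    patBA bx by_ bw gx gy gw rx ry rw =
      patBA bx by_ bw false false false rx ry rw * exactBA false false false gx gy gw +
      patBA bx by_ bw true false false rx ry rw * exactBA true false false gx gy gw +
      patBA bx by_ bw false true false rx ry rw * exactBA false true false gx gy gw +
      patBA bx by_ bw false false true rx ry rw * exactBA false false true gx gy gw +
      patBA bx by_ bw true true false rx ry rw * exactBA true true false gx gy gw +
      patBA bx by_ bw true false true rx ry rw * exactBA true false true gx gy gw +
      patBA bx by_ bw false true true rx ry rw * exactBA false true true gx gy gw +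
      patBA bx by_ bw true true true rx ry rw * exactBA true true true gx gy gw := by
  cases gx <;> cases gy <;> cases gw <;> simp [exactBA]

/-- **Validity** of root-side bits: transitivity on the triangles `{a₁, a₂, c}` and `{a₁, a₂, o}`. -/
def Valid5b (r : R5b) : Bool :=
  (!(r.a1 && r.a2) || r.q) && (!(r.a1 && r.q) || r.a2) && (!(r.a2 && r.q) || r.a1) &&
    (!(r.lo && r.ho) || r.q) && (!(r.lo && r.q) || r.ho) && (!(r.ho && r.q) || r.lo)

/-- The six-fold symmetrisation of a pattern kernel over the root copies. -/
def symBA (bx by_ bw sx sy sw : Bool) (rx ry rw : R5b) : ℤ :=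
  patBA bx by_ bw sx sy sw rx ry rw + patBA bx by_ bw sx sy sw rx rw ry +
    patBA bx by_ bw sx sy sw ry rx rw + patBA bx by_ bw sx sy sw ry rw rx +
    patBA bx by_ bw sx sy sw rw rx ry + patBA bx by_ bw sx sy sw rw ry rx

/-- The orbit `O₀` (`b` alone, no `a₃`): the sum of the three symmetrised pattern kernels. -/
def orbBA0 (rx ry rw : R5b) : ℤ :=
  symBA true false false false false false rx ry rw + symBA false true false false false false rx ry rw +
    symBA false false true false false false rx ry rw

/-- The orbit `O₁` (`a₃` in one copy other than the `b`-copy). -/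
def orbBA1 (rx ry rw : R5b) : ℤ :=
  symBA true false false false true false rx ry rw + symBA true false false false false true rx ry rw +
    symBA false true false true false false rx ry rw + symBA false true false false false true rx ry rw +
    symBA false false true true false false rx ry rw + symBA false false true false true false rx ry rw

/-- The orbit `O₂` (`a₃` in both other copies). -/
def orbBA2 (rx ry rw : R5b) : ℤ :=
  symBA true false false false true true rx ry rw + symBA false true false true false true rx ry rw +
    symBA false false true true true false rx ry rw

/-- The orbit `O₁′` (`a₃` in the `b`-copy only). -/
def orbBA1' (rx ry rw : R5b) : ℤ :=
  symBA true false false true false false rx ry rw + symBA false true false false true false rx ry rw +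
    symBA false false true false false true rx ry rw

/-- The orbit `O₂′` (`a₃` in the `b`-copy and one other). -/
def orbBA2' (rx ry rw : R5b) : ℤ :=
  symBA true false false true true false rx ry rw + symBA true false false true false true rx ry rw +
    symBA false true false true true false rx ry rw + symBA false true false false true true rx ry rw +
    symBA false false true true false true rx ry rw + symBA false false true false true true rx ry rw

/-- The orbit `O₃′` (`a₃` everywhere). -/
def orbBA3' (rx ry rw : R5b) : ℤ :=
  symBA true false false true true true rx ry rw + symBA false true false true true true rx ry rw +
    symBA false false true true true true rx ry rw

/-- **Orbit identity (a)**: `O₁′ = O₀` on valid triples (an `a₃` in the `b`-copy is invisible). -/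
theorem orbitBA_a (rx ry rw : R5b) (hx : Valid5b rx = true) (hy : Valid5b ry = true)
    (hw : Valid5b rw = true) : orbBA1' rx ry rw = orbBA0 rx ry rw := by
  revert rx ry rw
  decide +kernel

/-- **Orbit identity (b)**: `O₂′ = O₁` on valid triples. -/
theorem orbitBA_b (rx ry rw : R5b) (hx : Valid5b rx = true) (hy : Valid5b ry = true)
    (hw : Valid5b rw = true) : orbBA2' rx ry rw = orbBA1 rx ry rw := by
  revert rx ry rw
  decide +kernel

/-- **Orbit identity (c)**: `O₃′ = O₂` on valid triples. -/
theorem orbitBA_c (rx ry rw : R5b) (hx : Valid5b rx = true) (hy : Valid5b ry = true)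
    (hw : Valid5b rw = true) : orbBA3' rx ry rw = orbBA2 rx ry rw := by
  revert rx ry rw
  decide +kernel

end RootBridge

end CovForm

end Summit.Ventures.PercRepro2
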